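import Literature.Dynamics.NBody.AlbouyKaloshin2012SliceBranchesCC

/-!
# From one `T1234` branch system to finitely many positive central configurations

`T1234` companion of `AlbouyKaloshin2012SliceBranchesCC.lean`: `t1234PositiveCCs b c` is the set of positive
normalized central configurations (Definition 1 of [AlbouyKaloshin2012], p. 536) of the masses `(1,1,b,b,c)` in
the `T1234` normal form `t1234Q a₁ t₁ a₃ t₃ t₅` (pairs {1,2} and {3,4} mirror images in the `y`-axis, body 5
on the axis).  Chain: positive CC ⟹ system (4) with `δ = deltaOfPos` (`isRealNormalizedCC_of_isPositiveNormalizedCC`)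
⟹ `T1234Slice` (`isRealNormalizedCC_t1234_iff`, via the mirror-pattern identity `deltaOfPos_t1234Q`) ⟹ a
point of `t1234SliceSet b c`, finite iff the single branch system `σ = (1,1)` is (`t1234SliceSet_finite_iff_one`).
Hence `t1234PositiveCCs_finite_of_one`.  Together with `t12PositiveCCs_finite_of_two` this is the typed frame
for the cell's three branch computations at the Roberts masses `(1,1,1,1,1/4)` (`T12 ++++`, `T12 +++-`,
`T1234 ++`); nothing is asserted unconditionally.
-/

namespace Literature.Dynamics.NBody

/-- Positive normalized central configurations (Definition 1) of the masses `(1,1,b,b,c)` in the `T1234`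
normal form. [cite: AlbouyKaloshin2012, Definition 1 p. 536] -/
def t1234PositiveCCs (b c : ℝ) : Set (Fin 5 → ℝ × ℝ) :=
  {q | IsPositiveNormalizedCC (e32Masses b c) q ∧ ∃ a₁ t₁ a₃ t₃ t₅ : ℝ, q = t1234Q a₁ t₁ a₃ t₃ t₅}

/-- The inverse-distance matrix of a `T1234`-shaped configuration has the double-mirror pattern
`t1234Delta` (`δ₁₃ = δ₂₄`, `δ₁₄ = δ₂₃`, `δ₁₅ = δ₂₅`, `δ₃₅ = δ₄₅`). [folklore] -/
theorem deltaOfPos_t1234Q (a₁ t₁ a₃ t₃ t₅ : ℝ) :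
    deltaOfPos (t1234Q a₁ t₁ a₃ t₃ t₅) =
      t1234Delta (deltaOfPos (t1234Q a₁ t₁ a₃ t₃ t₅) 0 1) (deltaOfPos (t1234Q a₁ t₁ a₃ t₃ t₅) 2 3)
        (deltaOfPos (t1234Q a₁ t₁ a₃ t₃ t₅) 0 2) (deltaOfPos (t1234Q a₁ t₁ a₃ t₃ t₅) 0 3)
        (deltaOfPos (t1234Q a₁ t₁ a₃ t₃ t₅) 0 4) (deltaOfPos (t1234Q a₁ t₁ a₃ t₃ t₅) 2 4) := by
  funext k l
  fin_cases k <;> fin_cases l <;>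
    simp [deltaOfPos, t1234Delta, t1234Q, sqDist] <;> ring_nf

/-- **One branch system ⟹ finitely many positive `T1234` central configurations.** If the branch system
`σ = (1,1)` of `T1234Slice b c` has finitely many real solutions, then the masses `(1,1,b,b,c)` admit only
finitely many positive normalized central configurations (Definition 1 of [AlbouyKaloshin2012]) in the
`T1234` normal form. [cite: AlbouyKaloshin2012, Definition 1 p. 536; Definition 2 / system (4) p. 540 — derived in-tree] -/
theorem t1234PositiveCCs_finite_of_one (b c : ℝ) (h : (t1234BranchSet 1 1 b c).Finite) :
    (t1234PositiveCCs b c).Finite := by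
  have hS := (t1234SliceSet_finite_iff_one b c).2 h
  refine ((hS.image (fun X : T1234Pt => t1234Q X.a₁ X.t₁ X.a₃ X.t₃ X.t₅)).subset ?_)
  rintro q ⟨hq, a₁, t₁, a₃, t₃, t₅, rfl⟩
  have hreal := isRealNormalizedCC_of_isPositiveNormalizedCC hq
  rw [deltaOfPos_t1234Q] at hreal
  have hsl := (isRealNormalizedCC_t1234_iff b c a₁ t₁ a₃ t₃ t₅ _ _ _ _ _ _).1 hreal
  set q := t1234Q a₁ t₁ a₃ t₃ t₅ with hqdef
  exact ⟨⟨a₁, t₁, a₃, t₃, t₅, deltaOfPos q 0 1, deltaOfPos q 2 3, deltaOfPos q 0 2, deltaOfPos q 0 3,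
    deltaOfPos q 0 4, deltaOfPos q 2 4⟩, hsl, rfl⟩

end Literature.Dynamics.NBody
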